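import Literature.Barriers.BirchSwinnertonDyer.DescentDefectUnboundedKramerProofs
import Literature.NumberTheory.EllipticCurves.KramerDescentSelmerTwoSpanProofs
import HarnessLib

/-!
# Barrier (BirchSwinnertonDyer): `TwoDescentDefectUnbounded` from Kramer's two remaining leaves

`Proofs` companion of `Literature/Barriers/BirchSwinnertonDyer/DescentDefectUnbounded.lean`
for the barrier `Literature.Barriers.BirchSwinnertonDyer.TwoDescentDefectUnbounded` (the
`2`-descent defect `rk₂ Ш(E/ℚ)[2]` is unbounded over semistable `E/ℚ`; K. Kramer, Proc.
Amer. Math. Soc. **89** (1983), 379–386, Theorem of §5).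

State of the decomposition (2026-08-15). The barrier follows from
`Kramer1983_sha_twoRank_semistable`, which follows (`DescentDefectUnboundedKramerProofs`)
from the family fact `Literature.NumberTheory.EllipticCurves.Kramer1983_twoRank_sha_family`
(`KramerCurves`: the explicit curves, parameters (i)–(iv) exist, ellipticity and
semistability PROVED), which `KramerDescent.lean` reduces to three leaves, proving the
Legendre-symbol count `dim S(A/2A) ≤ |𝔏|+|𝔐|+1-2n`, the independence of the generators of
`S(A/gB)` and the `𝔽₂`-linear algebra. The third leaf `Kramer1983_selmerTwo_span` (the
containment halves of Lemma 2 and the necessity of `(a_p)`, `(b_q)` for rational points) is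
PROVED in `KramerDescentSelmerTwoSpanProofs` (with `KramerTwoDescentValuation`,
`KramerTwoDescentLocal`, `KramerTwoDescentSquares`). This file records the resulting
assembly: the barrier now rests on exactly the two named facts

* `Literature.NumberTheory.EllipticCurves.Kramer1983_selmerG_generators_local` — Lemma 2 with
  the Remark of §4, equality halves: the classes of `-1` and of the primes of `𝔏 ∪ 𝔐` lie in
  `γ_v(A(ℚ_v))` at every place (local analysis of `A` over the completions: formal group at
  `2`, Tate curves at `𝔏 ∪ 𝔐`, Hensel at good primes, the real locus);
* `Literature.NumberTheory.EllipticCurves.Kramer1983_shaG_of_selmerG` — §3 (4), §5 (9)–(10):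
  the map `H¹(ℚ, B_g) = ℚ*/ℚ*² → H¹(ℚ, B)[2]` with kernel in `γ(A(ℚ))`, sending classes with
  local condition at `v` into the local kernel at `v` (Kummer theory of `B_g = ⟨(-¼, ⅛)⟩`
  in the tree's continuous cohomology, the dual isogeny `g : B → A` — cf. the explicit
  models of `KramerShaIsogeny`).

## References

* K. Kramer, Proc. Amer. Math. Soc. 89 (1983) 379–386, doi:10.1090/s0002-9939-1983-0715850-1:
  Theorem of §5 and its proof (pp. 383–384), Lemma 2, §3 (4), §5 (7)–(10). [Kramer1983]
  (held, read in full).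
-/

noncomputable section

open scoped Classical

namespace Literature.Barriers.BirchSwinnertonDyer

open Literature.NumberTheory.EllipticCurves

/-- **`Kramer1983_sha_twoRank_semistable` from the two remaining leaves** (local generators
of `S(A/gB)`; the global map `S(A/gB) → Ш(B, ℚ)_g`). [cite: Kramer1983, Theorem (§5)] -/
theorem Kramer1983_sha_twoRank_semistable_of_local_global
    (hloc : Kramer1983_selmerG_generators_local) (hglob : Kramer1983_shaG_of_selmerG) :
    Kramer1983_sha_twoRank_semistable :=
  Kramer1983_sha_twoRank_semistable_of_family
    (KramerTwoDescent.Kramer1983_twoRank_sha_family_of_local_global hloc hglob)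

/-- **The barrier `TwoDescentDefectUnbounded` from the two remaining leaves.**
[cite: Kramer1983, Theorem (§5)] -/
theorem twoDescentDefectUnbounded_of_local_global
    (hloc : Kramer1983_selmerG_generators_local) (hglob : Kramer1983_shaG_of_selmerG) :
    TwoDescentDefectUnbounded :=
  twoDescentDefectUnbounded_of_kramer (Kramer1983_sha_twoRank_semistable_of_local_global hloc hglob)

end Literature.Barriers.BirchSwinnertonDyer

end
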